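import Summits.Ventures.HSemireg.WedgeHankelRankOne

/-!
# Venture HSemireg — HANKEL RANK ONE IS DEGREE-INDEPENDENT: for EVERY `1 ≤ k ≤ N − 1`, **`rank H_k(q) ≤ 1 ⟺ q` is an exponential `Aλ^•` or the point `c·δ_N` on `{0, …, N}` ⟺
# `rank H_1(q) ≤ 1`** — the rank-one classification of `WedgeHankelRankOne` (stated there for `H_1`) holds verbatim for every intermediate catalecticant; in particular the
# degenerate trichotomy (D8) can be read off any single degree

HONEST FRAMING. Part of the Lean index of the computation cell `pub-hsemireg` (seat p10 gen 25, Sunday typer «UNIFORM-IN-n»).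
LINEAR ALGEBRA OF HANKEL (catalecticant) MATRICES over a field ONLY: no variety, no cohomology theory, no sheaf, no Ext group and no semiregularity map is constructed here; nothing here says
that HC / HC_CM / HC_AV holds; no Literature fact is declared or used.  Custodian versions as in `WedgeHankelRankOne`; the dictionary (`A·exp(λΘ)` ↦ `Aλ^j`, `pt` ↦ `δ_N`) is QUOTED,
never asserted.  The degree-independence was first CHECKED by brute force (`GF(p)`, `p ≤ 5`, `N ≤ 6`, all `q`, all `k`; script `rankone.py` in the seat folder), then proved.

WHAT IS IN THE TREE.  `WedgeHankelRankOne`: `minor_eq_zero_of_rank_le_one` (the `2 × 2` minors of `H_1`), **`rank_hankel1_one_le_one_iff`** (`m ≥ 1`: `rank H_1(q) ≤ 1 ⟺ (∃ A λ, q_j = Aλ^j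
∀ j ≤ m) ∨ (q_j = 0 ∀ j < m)`), `hankel1_eq_hankel1_expSeq` / `hankel1_eq_hankel1_ppSeq`; Mathlib `Matrix.rank_submatrix_le`, `Matrix.rank_vecMulVec_le`.
THIS FILE (namespace `Summit.Ventures.HSemireg.Wedge.HankelOuter`; imports `WedgeHankelRankOne`):
* §452 **`minor_eq_zero_of_rank_hankel1_le_one`** (ANY degree `k`: `rank H_k(q) ≤ 1 ⇒ q_{i+s} q_{i′+t} = q_{i+t} q_{i′+s}` for `i, i′ ≤ k`, `s, t ≤ N − k`), `eq_expSeq_of_rank_hankel1_le_one`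
  (`q_0 ≠ 0`, `1 ≤ k ≤ N − 1`: `q_j = q_0 (q_1/q_0)^j` for ALL `j ≤ N` — every `j ≥ 2` splits as `i′ + t` with `1 ≤ i′ ≤ k`, `1 ≤ t ≤ N − k`), `eq_zero_of_rank_hankel1_le_one` (`q_0 = 0`: the
  CONSECUTIVE minors `q_{j−1} q_{j+1} = q_j²`, `1 ≤ j ≤ N − 1`, force `q_j = 0` for `j < N`), `rank_hankel1_le_one_of_expSeq`, `rank_hankel1_le_one_of_zero` (column ⊗ row).
* §453 **`rank_hankel1_le_one_iff`** (`1 ≤ k ≤ N − 1`: `rank H_k(q) ≤ 1 ⟺ (∃ A λ, ∀ j ≤ N, q_j = Aλ^j) ∨ (∀ j < N, q_j = 0)`), **`rank_hankel1_le_one_iff_rank_hankel1_one_le_one`**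
  (RANK ONE IS DEGREE-INDEPENDENT: `rank H_k(q) ≤ 1 ↔ rank H_1(q) ≤ 1`), `rank_hankel1_le_one_iff_of_le` (any two degrees `1 ≤ k, k′ ≤ N − 1`).
READING: D8's trichotomy (a class killed by a `1`-form is zero, pure or the point) can be read off ANY intermediate catalecticant; with M14/N5 the rank-one column spaces are exactly the
Veronese points `K·ν_k(λ)` and `K·e_k = K·ν_k(∞)` — the rational normal curve itself.  NOT typed here: the boundary degrees `k = 0`, `k = N` (one row / one column: every `q` has rank
`≤ 1` there).  Nothing Ext-side.  New names only.
-/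

open Module

namespace Summit.Ventures.HSemireg.Wedge.HankelOuter

open Summit.Ventures.HSemireg.Wedge Summit.Ventures.HSemireg.Wedge.Hankel Summit.Ventures.HSemireg.Wedge.HankelFaces Summit.Ventures.HSemireg.Wedge.HankelRankOne

variable (K : Type*) [Field K] {N : ℕ}

/-! ## §452. The `2 × 2` minors of `H_k(q)` and the two cases -/

/-- **`rank H_k(q) ≤ 1 ⇒ q_{i+s} · q_{i′+t} = q_{i+t} · q_{i′+s}`** for all rows `i, i′ ≤ k` and columns `s, t ≤ N − k` (otherwise the `2 × 2` submatrix on rows `i, i′` and columns `s, t`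
is invertible, of rank `2`). -/
theorem minor_eq_zero_of_rank_hankel1_le_one {k : ℕ} {q : ℕ → K} (h : (hankel1 K N k q).rank ≤ 1) {i i' s t : ℕ} (hi : i ≤ k) (hi' : i' ≤ k) (hs : s ≤ N - k) (ht : t ≤ N - k)
    (hkN : k ≤ N) : q (i + s) * q (i' + t) = q (i + t) * q (i' + s) := by
  by_contra hne
  let r : Fin 2 → Fin (k + 1) := ![⟨i, by omega⟩, ⟨i', by omega⟩]
  let c : Fin 2 → Fin (N + 1 - k) := ![⟨s, by omega⟩, ⟨t, by omega⟩]
  let M : Matrix (Fin 2) (Fin 2) K := (hankel1 K N k q).submatrix r c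
  have hdet : M.det = q (i + s) * q (i' + t) - q (i + t) * q (i' + s) := by
    rw [Matrix.det_fin_two]
    simp only [M, r, c, Matrix.submatrix_apply, hankel1, Matrix.of_apply, Matrix.cons_val_zero, Matrix.cons_val_one]
  have hunit : IsUnit M := by
    rw [Matrix.isUnit_iff_isUnit_det, hdet, isUnit_iff_ne_zero]
    exact sub_ne_zero.mpr hne
  have h2 : M.rank = 2 := by rw [Matrix.rank_of_isUnit M hunit, Fintype.card_fin]
  have hle : M.rank ≤ (hankel1 K N k q).rank := Matrix.rank_submatrix_le _ _ _
  omega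

/-- `q_0 ≠ 0`, `1 ≤ k ≤ N − 1`, `rank H_k(q) ≤ 1` ⇒ `q_j = q_0 · (q_1/q_0)^j` for ALL `j ≤ N` (every `j ≥ 2` is `i′ + t` with `1 ≤ i′ ≤ k`, `1 ≤ t ≤ N − k`; the minor on rows `0, i′`,
columns `0, t` gives `q_0 q_j = q_t q_{i′}`). -/
theorem eq_expSeq_of_rank_hankel1_le_one {k : ℕ} (hk : 1 ≤ k) (hkN : k + 1 ≤ N) {q : ℕ → K} (h : (hankel1 K N k q).rank ≤ 1) (h0 : q 0 ≠ 0) :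
    ∀ j ≤ N, q j = q 0 * (q 1 / q 0) ^ j := by
  intro j
  induction j using Nat.strong_induction_on with
  | _ j ih =>
    intro hj
    rcases Nat.lt_or_ge j 2 with hj2 | hj2
    · interval_cases j
      · rw [pow_zero, mul_one]
      · rw [pow_one, mul_div_cancel₀ _ h0]
    · -- split `j = i′ + t`, `1 ≤ i′ ≤ k`, `1 ≤ t ≤ N − k`
      set i' := max 1 (j - (N - k)) with hi'
      have hi'1 : 1 ≤ i' := le_max_left _ _
      have hi'k : i' ≤ k := by rw [hi']; exact max_le hk (by omega)
      have hi'j : i' ≤ j - 1 := by rw [hi']; exact max_le (by omega) (by omega)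
      have hmin := minor_eq_zero_of_rank_hankel1_le_one K h (i := 0) (i' := i') (s := 0) (t := j - i') (Nat.zero_le _) hi'k (Nat.zero_le _) (by omega) (by omega)
      rw [zero_add, zero_add, add_zero, show i' + (j - i') = j by omega] at hmin
      -- `q 0 * q j = q (j - i′) * q i′`
      have e : q j = q (j - i') * q i' / q 0 := by field_simp; linear_combination hmin
      rw [e, ih (j - i') (by omega) (by omega), ih i' (by omega) (by omega)]
      field_simp
      rw [← pow_add, show j - i' + i' = j by omega]

/-- `q_0 = 0`, `1 ≤ k ≤ N − 1`, `rank H_k(q) ≤ 1` ⇒ `q_j = 0` for all `j < N` (the CONSECUTIVE minors `q_{j−1} q_{j+1} = q_j²`, `1 ≤ j ≤ N − 1`, from rows `i, i+1`, columns `s, s+1`). -/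
theorem eq_zero_of_rank_hankel1_le_one {k : ℕ} (hk : 1 ≤ k) (hkN : k + 1 ≤ N) {q : ℕ → K} (h : (hankel1 K N k q).rank ≤ 1) (h0 : q 0 = 0) :
    ∀ j < N, q j = 0 := by
  intro j
  induction j with
  | zero => exact fun _ => h0
  | succ j ih =>
    intro hj
    -- rows `i, i+1`, columns `s, s+1` with `i + s = j`, `i ≤ k − 1`, `s ≤ N − k − 1`
    set i := min j (k - 1) with hi
    have hik : i ≤ k - 1 := min_le_right _ _
    have hij : i ≤ j := min_le_left _ _
    have hs : j - i ≤ N - k - 1 := by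
      rcases le_total j (k - 1) with hjk | hjk
      · rw [hi, min_eq_left hjk]; omega
      · rw [hi, min_eq_right hjk]; omega
    have hmin := minor_eq_zero_of_rank_hankel1_le_one K h (i := i) (i' := i + 1) (s := j - i) (t := j - i + 1) (by omega) (by omega) (by omega) (by omega) (by omega)
    rw [show i + (j - i) = j by omega, show i + 1 + (j - i + 1) = j + 2 by omega, show i + (j - i + 1) = j + 1 by omega, show i + 1 + (j - i) = j + 1 by omega,
      ih (by omega), zero_mul] at hmin
    exact pow_eq_zero_iff (n := 2) two_ne_zero |>.mp (by rw [pow_two]; exact hmin.symm)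

/-- the catalecticant `H_k` of an exponential on `{0, …, N}` is `column ⊗ row`, of rank `≤ 1` (every `k ≤ N`). -/
theorem rank_hankel1_le_one_of_expSeq {k : ℕ} (hkN : k ≤ N) {q : ℕ → K} {A lam : K} (hq : ∀ j ≤ N, q j = A * lam ^ j) :
    (hankel1 K N k q).rank ≤ 1 := by
  have e : hankel1 K N k q = Matrix.vecMulVec (fun i : Fin (k + 1) => lam ^ (i : ℕ)) (fun s : Fin (N + 1 - k) => A * lam ^ (s : ℕ)) := by
    ext i s
    rw [hankel1, Matrix.of_apply, Matrix.vecMulVec_apply, hq _ (by have := i.isLt; have := s.isLt; omega), pow_add]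
    ring
  rw [e]
  exact Matrix.rank_vecMulVec_le _ _

/-- the catalecticant `H_k` of a sequence vanishing below `N` is `column ⊗ row` (one corner entry), of rank `≤ 1` (`k ≤ N`). -/
theorem rank_hankel1_le_one_of_zero {k : ℕ} (hkN : k ≤ N) {q : ℕ → K} (hq : ∀ j < N, q j = 0) :
    (hankel1 K N k q).rank ≤ 1 := by
  have e : hankel1 K N k q = Matrix.vecMulVec (fun i : Fin (k + 1) => if (i : ℕ) = k then q N else 0)
      (fun s : Fin (N + 1 - k) => if (s : ℕ) + k = N then (1 : K) else 0) := by
    ext i s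
    rw [hankel1, Matrix.of_apply, Matrix.vecMulVec_apply]
    have hi := i.isLt; have hs := s.isLt
    by_cases him : (i : ℕ) + (s : ℕ) = N
    · rw [if_pos (by omega), if_pos (by omega), him, mul_one]
    · rw [hq _ (by omega)]
      by_cases hik : (i : ℕ) = k
      · rw [if_pos hik, if_neg (by omega), mul_zero]
      · rw [if_neg hik, zero_mul]
  rw [e]
  exact Matrix.rank_vecMulVec_le _ _

/-! ## §453. The rank-one classification in every degree; degree-independence -/

/-- **THE RANK-ONE CLASSIFICATION IN EVERY DEGREE (`1 ≤ k ≤ N − 1`): `rank H_k(q) ≤ 1 ⟺ (∃ A λ, q_j = Aλ^j for all j ≤ N) ∨ (q_j = 0 for all j < N)`** — an exponential (`A = 0`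
allowed) or the point `q_N · δ_N`; every field. -/
theorem rank_hankel1_le_one_iff {k : ℕ} (hk : 1 ≤ k) (hkN : k + 1 ≤ N) (q : ℕ → K) :
    (hankel1 K N k q).rank ≤ 1 ↔ (∃ A lam : K, ∀ j ≤ N, q j = A * lam ^ j) ∨ (∀ j < N, q j = 0) := by
  constructor
  · intro h
    by_cases h0 : q 0 = 0
    · exact Or.inr (eq_zero_of_rank_hankel1_le_one K hk hkN h h0)
    · exact Or.inl ⟨q 0, q 1 / q 0, eq_expSeq_of_rank_hankel1_le_one K hk hkN h h0⟩
  · rintro (⟨A, lam, hq⟩ | hq)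
    · exact rank_hankel1_le_one_of_expSeq K (by omega) hq
    · exact rank_hankel1_le_one_of_zero K (by omega) hq

/-- **HANKEL RANK ONE IS DEGREE-INDEPENDENT: `rank H_k(q) ≤ 1 ↔ rank H_1(q) ≤ 1`** for every `1 ≤ k ≤ N − 1` (both say: `q` is an exponential or the point on `{0, …, N}`). -/
theorem rank_hankel1_le_one_iff_rank_hankel1_one_le_one {k : ℕ} (hk : 1 ≤ k) (hkN : k + 1 ≤ N) (q : ℕ → K) :
    (hankel1 K N k q).rank ≤ 1 ↔ (hankel1 K N 1 q).rank ≤ 1 := by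
  rw [rank_hankel1_le_one_iff K hk hkN q, rank_hankel1_one_le_one_iff K (by omega) q]

/-- … hence **`rank H_k(q) ≤ 1 ↔ rank H_{k′}(q) ≤ 1`** for any two degrees `1 ≤ k, k′ ≤ N − 1`. -/
theorem rank_hankel1_le_one_iff_of_le {k k' : ℕ} (hk : 1 ≤ k) (hkN : k + 1 ≤ N) (hk' : 1 ≤ k') (hk'N : k' + 1 ≤ N) (q : ℕ → K) :
    (hankel1 K N k q).rank ≤ 1 ↔ (hankel1 K N k' q).rank ≤ 1 := by
  rw [rank_hankel1_le_one_iff_rank_hankel1_one_le_one K hk hkN q, rank_hankel1_le_one_iff_rank_hankel1_one_le_one K hk' hk'N q]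

end Summit.Ventures.HSemireg.Wedge.HankelOuter
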